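import Summits.AtomisticToContinuum.BoseEinsteinCondensation.Theses.BECThomsonPrinciple
import Literature.MathematicalPhysics.QuantumManyBody.PeriodicBoseGasFourier
import Literature.MathematicalPhysics.QuantumManyBody.PeriodicBoseGasFracEnergy

/-!
# Line `parseval-shell-bootstrap` for crux `BECThomsonPrinciple.FibreConductance`
(stmt-AtomisticToContinuum-9480) — skeleton (crux-plan round 1); line card `Lines/parseval-shell-bootstrap.md`

**The crux** (rank 3 of route `BECThomsonPrinciple`): for bounded repulsive finite-range `v`, every
window parameter `M`, every exact zero-free `C¹` minimiser `Φ` on the torus and every window mode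
`k = 2πn/L`, `2π‖n‖/L ≤ M√ρ`: ONE flow `J` in the `x₀`-fibre with weak divergence the fibre-neutral
charge `q = L^{-3/2}(e^{ik·x₀}ψ − βψ²)` and cost `∫|J|²W/ψ² ≤ C L²/‖n‖²`
(`W(X̂) = ∫|Φ(y,X̂)|²dy`, `ψ = |Φ|/√W`, `β = ∫e^{ik·y}ψ dy`).

**The line (idea `parseval-shell-bootstrap`, triage r1: pass ×3, "merge with healing-split:
same lever").** Transport along the conditional amplitude, `J₀ = L^{-3/2}e^{ik·x₀}ψ k/(i|k|²)`,
costs EXACTLY `1/|k|₂² = L²/(4π²|n|₂²)` in every landscape and has weak divergence `q + ε`,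
`ε = L^{-3/2}[e^{ik·x₀}(k·∇₀ψ)/(i|k|²) + βψ²]`. This skeleton organises the corrector for `ε` on
the FOURIER side of the fibre and isolates the infrared content at its MINIMAL strength:

1. FLAT-NEUTRAL SPLIT `ε = ε♭ + ε♮`, `ε♭ = L^{-3/2}[e^{ik·x₀}(k·∇₀ψ)/(i|k|²) + β/L³]` (the
   GRADIENT CHARGE, made neutral by a constant) and `ε♮ = L^{-3/2}β(ψ² − L⁻³)` (β times the
   fluctuation of the conditional DENSITY). Both are fibre-neutral (`∫e^{ik·y}k·∇ψ = −i|k|²β`,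
   `∫ψ²dy = 1`).
2. PARSEVAL SIDE (`stub_parsevalShell`): the bath-averaged FLAT corrector energy of `ε♭` is a pure
   occupation sum, `∫_{cellN} W·flatEnergy = (1/N) Σ_{p≠0} (k·k_{p−n})² n_{p−n}(|Φ|) /(|k|⁴|k_p|²)`
   (fibre Parseval `cellFourierCoeff_fderiv` + `hasSum_sq_cellFourierCoeff`, and
   `E_W|ĉ_q(ψ)|² = L⁻³ n_q(|Φ|)/N`). EVERY mode with `|k_p| ≥ min(θ√ρ, |k|/2)` is FREE by
   `Σ_q n_q = N` alone (weights `≤ 9` and `≤ 27M²/(4θ²)`); no kinetic/Dyson cut is needed on the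
   flat side. Only the RESONANT SHELL `0 < |k_p| < min(θ√ρ, |k|/2)` (fibre modes beating with the
   landscape mode `p − n ≈ −n`) needs an infrared input, and only through the lattice count
   `Σ_{0<|p|<p₁} |p|⁻² ≤ C p₁`.
3. INFRARED INPUT AT MINIMAL STRENGTH (`stub_shellOccupation`, HARDEST): single-mode occupations of
   `|Φ|` on the shell `‖p′ + n‖ < p₁`, `p₁ ≤ min(θ√ρL/2π, ‖n‖/2)`, are `≤ K·N/(‖n‖²p₁)`. This is the
   `ℓ¹` form of what the crux itself FORCES (InfraredNecessity from Disproof §D: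
   `n_{p′} ≲ 4π²C·N/‖n‖²` at `p₁ = 1`); it is NOT BEC-strength (summed over the window it is `≫ N`,
   unlike the KLS-shaped `n_{p′} ≤ K(1+√ρ/|p′|)` of the sibling line, which gives `n₀ ≥ (1−o(1))N`),
   and Bogoliubov passes it with room `≍ (M²√(ρa))⁻¹`. Empty (no input) for `‖n‖ = 1`.
4. LANDSCAPE SIDE, two statements, both using (H1): `stub_gradientComparability` — the gradient
   charge has a corrector whose WEIGHTED cost is `≤ K × (bath-averaged flat energy) + K L²/‖n‖²`
   (two-scale: Bogovskiĭ/local Poincaré on cubes of a fixed side `ℓ₀` with local comparability ×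
   local log-gradient moments — "dips are depth-independent"; a coarse flow on the cube lattice with
   Grimmett–Kesten–Zhang detours around sparse bad cubes on good bath configurations, where the
   landscape factor is a DETERMINISTIC constant so that only `E_W[flatEnergy]` is consumed; Dyson's
   proved bound `LSSY2005_upperBound_periodic_holds` for `ℓ₀²‖ε♭‖²₂`; the k-blind Poincaré bound on
   the rare bad configurations); and the k-FREE `stub_densityFlattening` — the conditional density
   `ψ(·|X̂)²` can be driven to `L⁻³` by a fibre flow `J_d` with `E_W[D²] ≤ K L²`,
   `D = ∫|J_d|²/ψ²dy` ("only closed shells cost": cages are paid here once, k-independently; the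
   Reatto–Chester phonon tail makes `E_W D ≍ (c/ρ) log(L/ξ)`, far inside `K L²`).
5. β-CHANNEL (`stub_betaCorrector`): `J♮ = L^{-3/2}β·J_d`, Cauchy–Schwarz in the bath,
   `E_W|β|²/L³ = n_{−n}(|Φ|)/N` and the shell bound at `p′ = −n`: cost `≤ √(KK_d)·L/(‖n‖√p₁)
   ≤ C L²/‖n‖²` for `L ≥ L₀` (both cases of `p₁`).
6. TRANSPORT REDUCTION (`stub_transport`): `J = J₀ − J♭ − J♮`, the two identities of `J₀`
   (integration by parts on the torus in `x₀`, `∫_{cellN} W = L³`), `β ∈ C¹` periodic so that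
   `βη` is a test function, costs subadditive up to `3`, `|n|₂ ≥ ‖n‖_∞`.

Composition (sorry-free, in this file): `gradientCorrectorBound_of : GradientComparability →
FlatBound → GradientCorrectorBound` (arithmetic under the common prefix) and
`FibreConductance_of : Goal.stub_transport → Goal.stub_parsevalShell → Goal.stub_betaCorrector →
Goal.stub_gradientComparability → Goal.stub_densityFlattening → Goal.stub_shellOccupation →
FibreConductance` = `t (gradientCorrectorBound_of g (p s)) (b d s)`.

**Disproof.lean v5 honoured** (read through its item-evidence abstracts — `run/gate/evidence` is not
mounted in planner jails, as for every seat on this crux): §E `not_fibreConductanceSharp` — the main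
term of `stub_transport` IS the floor `L²/(4π²|n|₂²)`; §G1/§G3 — at `v = 0`, `ψ ≡ L^{-3/2}`, `β = 0`,
`ε♭ = ε♮ = 0`, all correctors vanish and `J = J₀ =` the disprover's canonical flow; §G2
`not_fibreConductanceWithoutMinimiser` — (H1) is a binder of exactly the three bath-law stubs
(`gradientComparability`, `densityFlattening`, `shellOccupation`): the slab-cage product state
violates all three (walls of conductivity `e^{−2K}` spanning the torus make the flattening cost `≍ L²e^{2K}`
and put `n_{±2e} ≍ N` on the resonant mode), never the three analytic stubs; §F — bounded `v` is a
binder only; §D `pairing_le_of_isFibreFlow` — the duality behind InfraredNecessity, which is WHY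
`stub_shellOccupation` cannot be weakened below the `p₁ = 1` form. No `Negative/` lemma has landed
for this crux (nothing to import).

Stubs (6, sorried; statements = the `def`s of §2, audit aliases `Goal.stub_*`): `stub_transport`
(M/L, deterministic), `stub_parsevalShell` (M/L, deterministic Fourier bookkeeping, the card's
computation), `stub_betaCorrector` (M, deterministic given its two inputs), `stub_gradientComparability`
(L/XL, landscape half for the oscillating charge, uses (H1)), `stub_densityFlattening` (L, landscape
half k-free, uses (H1)), `stub_shellOccupation` (XL, HARDEST, the infrared content, uses (H1)).
-/

noncomputable section

namespace Summit.AtomisticToContinuum.BoseEinsteinCondensation.Cruxes.FibreConductance.ParsevalShellBootstrap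

open MeasureTheory
open scoped ENNReal
open Literature.MathematicalPhysics.QuantumManyBody.BoseGas
open Summit.AtomisticToContinuum.BoseEinsteinCondensation.Theses.BECThomsonPrinciple (FibreConductance)

variable {m : ℕ} {L : ℝ}

/-! ## §0 Fibre vocabulary (syntactically the crux's `let`s, as functions of the datum) -/

/-- `e^{ik·x}`, `k = 2πn/L` (verbatim the crux's phase factor). [folklore] -/
def phase (L : ℝ) (n : Fin 3 → ℤ) (x : Space) : ℂ :=
  Complex.exp (Complex.I * ↑(2 * Real.pi / L * ∑ j, (n j : ℝ) * x j))

/-- `|k|² = (2π/L)² Σ_j n_j²` (Euclidean; `≥ (2π‖n‖_∞/L)²`). [folklore] -/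
def ksq (L : ℝ) (n : Fin 3 → ℤ) : ℝ :=
  (2 * Real.pi / L) ^ 2 * ∑ j, (n j : ℝ) ^ 2

/-- Bath weight `W(X̂) = ∫_cell ‖Φ(y, X̂)‖² dy` (the crux's `W`; constant along the `x₀`-fibre,
`∫_{cell^m} W = 1`, `∫_{cellN} W = L³`). [folklore] -/
def fibreW (Φ : PeriodicTrialState (m + 1) L) (X : Config (m + 1)) : ℝ :=
  ∫ y in cell L, ‖Φ.ψ (Function.update X 0 y)‖ ^ 2

/-- Conditional amplitude `ψ = ‖Φ‖/√W` of particle `0` given the bath (the crux's `ψ`;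
`∫_cell ψ² dy = 1` on every fibre). [folklore] -/
def fibrePsi (Φ : PeriodicTrialState (m + 1) L) (X : Config (m + 1)) : ℝ :=
  ‖Φ.ψ X‖ / Real.sqrt (fibreW Φ X)

/-- `β(X̂) = ∫_cell e^{ik·y} ψ(y, X̂) dy` (the crux's `β`; `|β|² ≤ L³`,
`E_W |β|²/L³ = n_{−n}(|Φ|)/N`). [folklore] -/
def fibreBeta (n : Fin 3 → ℤ) (Φ : PeriodicTrialState (m + 1) L) (X : Config (m + 1)) : ℂ :=
  ∫ y in cell L, phase L n y * (fibrePsi Φ (Function.update X 0 y) : ℂ)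

/-- `∂ψ/∂x_{0,l}`: partial derivative of the conditional amplitude in the fibre variable. [folklore] -/
def dPsi (Φ : PeriodicTrialState (m + 1) L) (X : Config (m + 1)) (l : Fin 3) : ℝ :=
  fderiv ℝ (fibrePsi Φ) X (Pi.single 0 (EuclideanSpace.single l (1 : ℝ)))

/-- The flat-neutralised GRADIENT CHARGE `ε♭ = L^{-3/2}[e^{ik·x₀}(k·∇₀ψ)/(i|k|²) + β/L³]`
(fibre-neutral: `∫_cell e^{ik·y} k·∇ψ dy = −i|k|²β`). [folklore] -/
def gradDefect (n : Fin 3 → ℤ) (Φ : PeriodicTrialState (m + 1) L) (X : Config (m + 1)) : ℂ :=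
  ((Real.sqrt (L ^ 3))⁻¹ : ℂ) *
    (phase L n (X 0) * (↑(∑ l : Fin 3, 2 * Real.pi * (n l : ℝ) / L * dPsi Φ X l) /
        (Complex.I * (ksq L n : ℂ))) +
      fibreBeta n Φ X / ((L : ℂ) ^ 3))

/-- The β-CHARGE `ε♮ = L^{-3/2} β (ψ² − L⁻³)` (β times the conditional-density fluctuation;
fibre-neutral since `∫ψ² = 1`). `ε♭ + ε♮ = ε = div₀J₀ − q`. [folklore] -/
def densDefect (n : Fin 3 → ℤ) (Φ : PeriodicTrialState (m + 1) L) (X : Config (m + 1)) : ℂ :=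
  ((Real.sqrt (L ^ 3))⁻¹ : ℂ) * fibreBeta n Φ X * ↑(fibrePsi Φ X ^ 2 - (L ^ 3)⁻¹)

/-- Weak divergence in the fibre variable on the torus, `∫ J·∇₀η = −∫ σ η` for every `C¹` test
function periodic in every particle and axis (verbatim the crux's clause, charge `σ`). [folklore] -/
def HasWeakDiv (L : ℝ) (J : Config (m + 1) → (Fin 3 → ℂ)) (σ : Config (m + 1) → ℂ) : Prop :=
  ∀ η : Config (m + 1) → ℂ, ContDiff ℝ 1 η →
    (∀ X (i : Fin (m + 1)) (l : Fin 3), η (X + Pi.single i (EuclideanSpace.single l L)) = η X) →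
      ∫ X in cellN (m + 1) L, ∑ l : Fin 3, J X l *
          fderiv ℝ η X (Pi.single 0 (EuclideanSpace.single l (1 : ℝ))) =
        - ∫ X in cellN (m + 1) L, σ X * η X

/-- The crux's Thomson cost `∫_{cellN} |J|² W/ψ²` (verbatim). [folklore] -/
def fibreCost (Φ : PeriodicTrialState (m + 1) L) (J : Config (m + 1) → (Fin 3 → ℂ)) : ℝ≥0∞ :=
  ∫⁻ X in cellN (m + 1) L,
    ENNReal.ofReal ((∑ l : Fin 3, ‖J X l‖ ^ 2) * fibreW Φ X / fibrePsi Φ X ^ 2)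

/-- FLAT corrector energy of the gradient charge in the fibre of `X̂`:
`L³ Σ_{p≠0} |ĉ_p(ε♭(·,X̂))|²/|2πp/L|² = ∫_cell |J_flat|² dy`, `J_flat = ∇Δ⁻¹ε♭` on the flat torus
(`ĉ_p = cellFourierCoeff`, `ĉ_p(ε♭) = L^{-3/2}(k·k_{p−n}/|k|²) ĉ_{p−n}(ψ)` for `p ≠ 0`). [folklore] -/
def flatEnergy (n : Fin 3 → ℤ) (Φ : PeriodicTrialState (m + 1) L) (X : Config (m + 1)) : ℝ≥0∞ :=
  ENNReal.ofReal (L ^ 3) *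
    ∑' p : Fin 3 → ℤ, if p = 0 then 0 else
      ENNReal.ofReal (‖cellFourierCoeff L (fun y => gradDefect n Φ (Function.update X 0 y)) p‖ ^ 2 /
        ((2 * Real.pi / L) ^ 2 * ∑ j, (p j : ℝ) ^ 2))

/-- Fibre cost `D(X̂) = ∫_cell |J(y, X̂)|²/ψ(y, X̂)² dy` of a flow in the fibre of `X̂`
(so that `fibreCost Φ J = ∫_{cell^m} W·D = E_W[D]`). [folklore] -/
def fibreDensCost (Φ : PeriodicTrialState (m + 1) L) (J : Config (m + 1) → (Fin 3 → ℂ))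
    (X : Config (m + 1)) : ℝ≥0∞ :=
  ∫⁻ y in cell L, ENNReal.ofReal
    ((∑ l : Fin 3, ‖J (Function.update X 0 y) l‖ ^ 2) / fibrePsi Φ (Function.update X 0 y) ^ 2)

/-! ## §1 The common quantifier prefix of the crux -/

/-- `LowDensityWindow P`: for every bounded repulsive finite-range `v` and window parameter `M`
there are `ρ₀, C, N₀` such that `P m L n Φ C` holds for every datum of the crux — `N = m+1 ≥ N₀`
bosons, side `L > 0`, density `N/L³ ≤ ρ₀`, window mode `n ≠ 0` with `2π‖n‖/L ≤ M√(N/L³)`, and an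
exact zero-free minimiser `Φ`. Verbatim the prefix of `FibreConductance`. [folklore] -/
def LowDensityWindow
    (P : (m : ℕ) → (L : ℝ) → (Fin 3 → ℤ) → PeriodicTrialState (m + 1) L → ℝ → Prop) : Prop :=
  ∀ v : ℝ → ℝ≥0∞, IsRepulsiveFiniteRange v → (∃ B : ℝ, ∀ r, v r ≤ ENNReal.ofReal B) →
    ∀ M : ℝ, 0 < M → ∃ ρ₀ C : ℝ, 0 < ρ₀ ∧ 0 < C ∧ ∃ N₀ : ℕ, ∀ m : ℕ, N₀ ≤ m + 1 →
      ∀ L : ℝ, 0 < L → ((m + 1 : ℕ) : ℝ) ≤ ρ₀ * L ^ 3 → ∀ n : Fin 3 → ℤ, n ≠ 0 →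
        2 * Real.pi * ‖(fun j => (n j : ℝ))‖ / L ≤ M * Real.sqrt ((m + 1 : ℕ) / L ^ 3) →
          ∀ Φ : PeriodicTrialState (m + 1) L,
            periodicEnergy v Φ = periodicGroundStateEnergy v (m + 1) L → (∀ X, Φ.ψ X ≠ 0) →
              P m L n Φ C

/-! ## §2 The statements of the line -/

/-- GRADIENT CORRECTOR BOUND (intermediate goal; = `GradientComparability ∧ FlatBound` by
`gradientCorrectorBound_of`): a measurable fibre flow with weak divergence `ε♭` and cost
`≤ C L²/‖n‖²`. [folklore] -/
def GradientCorrectorBound : Prop :=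
  LowDensityWindow fun m L n Φ C =>
    ∃ J : Config (m + 1) → (Fin 3 → ℂ), Measurable J ∧ HasWeakDiv L J (gradDefect n Φ) ∧
      fibreCost Φ J ≤ ENNReal.ofReal (C * L ^ 2 / ‖(fun j => (n j : ℝ))‖ ^ 2)

/-- β-CORRECTOR BOUND (intermediate goal; from `DensityFlattening ∧ ShellOccupation` by
`stub_betaCorrector`): a measurable fibre flow with weak divergence `ε♮` and cost `≤ C L²/‖n‖²`.
[folklore] -/
def BetaCorrectorBound : Prop :=
  LowDensityWindow fun m L n Φ C =>
    ∃ J : Config (m + 1) → (Fin 3 → ℂ), Measurable J ∧ HasWeakDiv L J (densDefect n Φ) ∧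
      fibreCost Φ J ≤ ENNReal.ofReal (C * L ^ 2 / ‖(fun j => (n j : ℝ))‖ ^ 2)

/-- FLAT BOUND (intermediate goal, the Parseval side; from `ShellOccupation` by
`stub_parsevalShell`): the bath-averaged flat corrector energy of the gradient charge,
`∫_{cellN} W·flatEnergy = (1/N) Σ_{p≠0} (k·k_{p−n})² n_{p−n}(|Φ|)/(|k|⁴|k_p|²)`, is `≤ C L²/‖n‖²`.
[folklore] -/
def FlatBound : Prop :=
  LowDensityWindow fun m L n Φ C =>
    ∫⁻ X in cellN (m + 1) L, ENNReal.ofReal (fibreW Φ X) * flatEnergy n Φ X ≤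
      ENNReal.ofReal (C * L ^ 2 / ‖(fun j => (n j : ℝ))‖ ^ 2)

/-- **Statement of `stub_transport` — TRANSPORT REDUCTION (M/L; deterministic; no (H1)).**
Correctors for `ε♭` and `ε♮` of cost `O(L²/‖n‖²)` give the crux: `J := J₀ − J♭ − J♮` with the
explicit transport flow `J₀ = L^{-3/2}e^{ik·x₀}ψ k/(i|k|²)`, whose cost is
`∫|J₀|²W/ψ² = |k|⁻²L⁻³∫_{cellN}W = L²/(4π²|n|₂²) ≤ L²/(4π²‖n‖²)` exactly and whose weak divergence is
`q + ε♭ + ε♮` (integration by parts in `x₀` on the torus: `ψ = ‖Φ‖/√W` is `C¹` because `Φ` is `C¹`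
and zero-free and `W > 0`); `β` is `C¹` and periodic in the bath variables, so `βη` is a test
function; costs are subadditive up to the factor `3` (measurability of the three flows). At `v = 0`
all correctors vanish and `J = J₀` is the disprover's canonical flow (§G1); the constant is
`3(1/4π² + C♭ + C♮) ≥` the §E floor. Why it might fail: only through a slip in the two identities
(checked: `∫e^{ik·y}k·∇ψ = −i|k|²β` makes `ε♭`, `ε♮` separately neutral). (Refs: LyonsPeres2016, Ch. 2 (Thomson's principle: one admissible flow bounds the resistance).) -/
def TransportReduction : Prop :=
  GradientCorrectorBound → BetaCorrectorBound → FibreConductance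

/-- **Statement of `stub_gradientComparability` — GRADIENT COMPARABILITY (L/XL; landscape half for
the oscillating charge; uses (H1)).** For exact zero-free minimisers at density `≤ ρ₀` and every
window mode, the gradient charge `ε♭` has a measurable fibre flow whose WEIGHTED cost is at most
`K ×` the bath-averaged FLAT corrector energy `+ K L²/‖n‖²`. Intended proof (two-scale, real space —
triage r1-1/2/3: no Fourier cut on the weighted side): (a) local neutralisation on cubes of a fixed
side `ℓ₀` (Bogovskiĭ / local Poincaré with `sup_{Q*}ψ⁻²`), cost
`≤ Cℓ₀²(E_W[Σ_Q s_Q∫_Q|∇_yψ|²]/|k|² + E_{Born}[osc_{Q(x₀)}])` — "dips are depth-independent", local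
comparability `s_Q = sup_{Q*}(L³ψ²)⁻¹` jointly with local log-gradients, the `ℓ₀²`-term is k-blind and
`≤ ℓ₀²M²ρ₀·O(1)/|k|²`; (b) on GOOD bath configurations (the `S`-bad set `{L³ψ² < 1/S}` is covered by
well-separated balls) a coarse flow on the cube lattice with flat lattice energy
`≤ C(flatEnergy + ℓ₀²‖ε♭‖²₂)` rerouted around the dilated bad balls (Grimmett–Kesten–Zhang; the
detour map is a BOUNDED OPERATOR on flows, so oscillation/cancellation of the charge is preserved)
and realised by flux tubes where `L³ψ² ≥ 1/S`: the landscape factor is the deterministic `S`, whence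
only `E_W[flatEnergy]` is consumed; `ℓ₀²E_W‖ε♭‖²₂ ≤ ℓ₀²(T/N)/|k|² + O(ℓ₀²)` by the fibre Fisher
information `∫W|∇₀ψ|² = ∫|∇₀|Φ||² ≤ T/N ≤ 4πρa(1+o(1))` (Dyson, PROVED:
`LSSY2005_upperBound_periodic_holds`); (c) BAD configurations: flat corrector with the global
comparability factor and the k-blind Poincaré scale `L²`, paid by `P_W(bad) = O(L^{-p})` with moments
(local number tails of the Born law of `Ψ₀` = the unproved `LocalNumberTail`/Ruelle input shared with
the cage cards marginal-subsolution-shells / tagged-path-harnack-cage-moments). Why it might fail: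
(c) needs decorrelation of distant regions under `|Ψ₀|²dX` to make sparseness typical; a global
`sup`-comparability is NOT L-uniform (`s ≍ e^{c·n_max}`), so any proof that does not localise is void;
the slab cage of Disproof §G2 (non-minimiser) has `s = e^{2K}` on a torus-spanning wall and breaks
the statement without (H1). (Refs: GrimmettKestenZhang1993 (doi:10.1007/bf01195881; sparse bad regions cost a bounded factor for finite-energy flows); LSSY2005, Thm. 2.2.) -/
def GradientComparability : Prop :=
  LowDensityWindow fun m L n Φ K =>
    ∃ J : Config (m + 1) → (Fin 3 → ℂ), Measurable J ∧ HasWeakDiv L J (gradDefect n Φ) ∧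
      fibreCost Φ J ≤
        ENNReal.ofReal K * (∫⁻ X in cellN (m + 1) L, ENNReal.ofReal (fibreW Φ X) * flatEnergy n Φ X) +
          ENNReal.ofReal (K * L ^ 2 / ‖(fun j => (n j : ℝ))‖ ^ 2)

/-- **Statement of `stub_densityFlattening` — DENSITY FLATTENING (L; landscape half, k-FREE; uses
(H1)).** For exact zero-free minimisers at density `≤ ρ₀` (no window, no `k`): the conditional density
`ψ(·|X̂)²` of one particle given the others can be driven to the uniform density `L⁻³` by a measurable
fibre flow `J` (weak divergence `ψ² − L⁻³`) whose fibre cost `D(X̂) = ∫_cell|J|²/ψ²dy` has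
`E_W[D²] ≤ K L²`, written `∫_{cellN} W·D² ≤ K L⁵`. "Only closed shells cost": a cage of radius `r`
behind a wall of depth `K_w` costs `L⁻³r⁴w·e^{2K_w}`, so `D = Σ_{cages in the box} + typical` is
INTENSIVE and the statement is the summability of (Born probability) × `e^{2K_w}` — the crux's own
why-might-fail, isolated k-free; the typical part is `≍ (c/ρ)·log(L/ξ)` (Reatto–Chester phonon tail
`u ∼ r⁻²` of the conditional density; a Cauchy–Schwarz lower bound with `g = ρ̂_bath(k)` gives the same
order `1/((N S(k)+1)k²)` per mode), far inside `K L²`. Consumed only through Cauchy–Schwarz in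
`stub_betaCorrector`, which tolerates `E_W[D²]^{1/2} = O(L)`. Why it might fail: unbounded if the
conditional density tracked bath density with the bare two-body tail `a/k²` down to `k = 2π/L`
(`D ≍ ρa²L²/c`, i.e. no phonon screening in `Ψ₀`) AND cage probabilities decayed slower than
`e^{−4K_w}`; false for the slab product state of Disproof §G2 (`D ≍ L²e^{2K}` deterministically).
(Refs: ReattoChester1967 (doi:10.1103/PhysRev.155.88; long-range Jastrow tail from zero-point phonons); GrimmettKestenZhang1993.) -/
def DensityFlattening : Prop :=
  ∀ v : ℝ → ℝ≥0∞, IsRepulsiveFiniteRange v → (∃ B : ℝ, ∀ r, v r ≤ ENNReal.ofReal B) →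
    ∃ ρ₀ K : ℝ, 0 < ρ₀ ∧ 0 < K ∧ ∃ N₀ : ℕ, ∀ m : ℕ, N₀ ≤ m + 1 →
      ∀ L : ℝ, 0 < L → ((m + 1 : ℕ) : ℝ) ≤ ρ₀ * L ^ 3 →
        ∀ Φ : PeriodicTrialState (m + 1) L,
          periodicEnergy v Φ = periodicGroundStateEnergy v (m + 1) L → (∀ X, Φ.ψ X ≠ 0) →
            ∃ J : Config (m + 1) → (Fin 3 → ℂ), Measurable J ∧
              HasWeakDiv L J (fun X => ((fibrePsi Φ X ^ 2 - (L ^ 3)⁻¹ : ℝ) : ℂ)) ∧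
                ∫⁻ X in cellN (m + 1) L, ENNReal.ofReal (fibreW Φ X) * fibreDensCost Φ J X ^ 2 ≤
                  ENNReal.ofReal (K * L ^ 5)

/-- **Statement of `stub_shellOccupation` — SHELL OCCUPATION, THE INFRARED INPUT AT MINIMAL
STRENGTH (XL; HARDEST; uses (H1)).** For bounded repulsive finite-range `v` and window `M` there are
`θ, ρ₀, K, N₀` such that for every datum of the crux, every admissible shell radius
`0 < p₁ ≤ min(θ√ρ·L/2π, ‖n‖/2)` and every lattice mode `p` with `‖p + n‖_∞ < p₁`, the occupation of
the plane wave `φ_p` in `|Φ|` is `≤ K·N/(‖n‖²p₁)` (occupations of `X ↦ ‖Φ X‖`, which is what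
`E_W|ĉ_q(ψ)|²` computes; for the positive ground state these are the occupations of `Φ`). CONTENT:
an N-uniform single-mode occupation bound near the diagonal resonance `p ≈ −n`; at the window top it
reads `n_p ≲ 8π³K/(M²θ√ρ)` particles in one mode. It is (i) FORCED by the crux up to the factor
`1/p₁` (InfraredNecessity, Disproof §D: any admissible `J` costs
`≥ L⁻³E_W|ψ̂(P−k) − β(ψ²)^(P)|²/P²`, so the crux gives `n_{p′} ≲ 4π²C N/‖n‖²` for `p′` lattice-adjacent
to `−k`), hence cannot be dropped by ANY line; (ii) NOT BEC-strength — summed over the window it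
allows `Σ n_p ≍ KN(log + M/θ) ≫ N`, unlike a KLS-shaped bound `K(1+√ρ/|p|)`, which already gives
`n₀ ≥ (1−o(1))N` for exact minimisers; (iii) Bogoliubov-consistent with room: shell modes have
`|p′| ≥ ‖n‖/2`, `n_{p′} ≈ √(πρa)L/(2π|p′|)`, and the bound holds iff `M²√(ρa) ≲ K` resp.
`Mρ^{1/4}√(KK') ≲ √L`; (iv) EMPTY of content for `‖n‖ = 1` (`p₁ ≤ 1/2`: shell `= {−n}`, bound `≥ 2KN`).
Why it might fail: it is thermodynamic-limit information on exact ground states that no energy method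
gives (kinetic Chebyshev: `n_p ≤ 4πaN/M²`; a rogue mode with `ρ^{-1/2}L^{ε}` particles costs nothing
visible at LHY precision); no closure inside this crux (triage: coupling-continuity / profile-descent
fail at the window edge); the slab cage of §G2 violates it (`n_{±2e} ≍ N`). The tenure re-cut
`9480 ↦ FibreConductanceUnderIR` deletes exactly this stub, in this weakest form. (Refs: KennedyLiebShastry1988 (KLS occupation bounds, the shape this weakens); arXiv:1211.2778 (LNSS, `Λ†Λ = n_k`); LSSY2005, Thm. 2.2.) -/
def ShellOccupation : Prop :=
  ∀ v : ℝ → ℝ≥0∞, IsRepulsiveFiniteRange v → (∃ B : ℝ, ∀ r, v r ≤ ENNReal.ofReal B) →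
    ∀ M : ℝ, 0 < M → ∃ θ ρ₀ K : ℝ, 0 < θ ∧ 0 < ρ₀ ∧ 0 < K ∧ ∃ N₀ : ℕ, ∀ m : ℕ, N₀ ≤ m + 1 →
      ∀ L : ℝ, 0 < L → ((m + 1 : ℕ) : ℝ) ≤ ρ₀ * L ^ 3 → ∀ n : Fin 3 → ℤ, n ≠ 0 →
        2 * Real.pi * ‖(fun j => (n j : ℝ))‖ / L ≤ M * Real.sqrt ((m + 1 : ℕ) / L ^ 3) →
          ∀ Φ : PeriodicTrialState (m + 1) L,
            periodicEnergy v Φ = periodicGroundStateEnergy v (m + 1) L → (∀ X, Φ.ψ X ≠ 0) →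
              ∀ p₁ : ℝ, 0 < p₁ → p₁ ≤ θ * Real.sqrt ((m + 1 : ℕ) / L ^ 3) * L / (2 * Real.pi) →
                p₁ ≤ ‖(fun j => (n j : ℝ))‖ / 2 →
                  ∀ p : Fin 3 → ℤ, ‖(fun j => ((p j + n j : ℤ) : ℝ))‖ < p₁ →
                    cellOccupation (m + 1) L (planeWaveMode L p) (fun X => (‖Φ.ψ X‖ : ℂ)) ≤
                      ENNReal.ofReal (K * (m + 1 : ℕ) / (‖(fun j => (n j : ℝ))‖ ^ 2 * p₁))

/-- **Statement of `stub_parsevalShell` — PARSEVAL–SHELL BOUND (M/L; deterministic Fourier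
bookkeeping; the card's computation; no (H1) beyond its input).** `ShellOccupation → FlatBound`.
Proof plan: for `p ≠ 0`, `ĉ_p(ε♭(·,X̂)) = L^{-3/2}(k·k_{p−n}/|k|²)·ĉ_{p−n}(ψ(·|X̂))`
(`cellFourierCoeff_fderiv`, `y ↦ ψ(X[0↦y])` is `C¹` periodic), `∫W|ĉ_q(ψ)|²dX̂ = L⁻³n_q(|Φ|)/N`
(Fubini; `cellOccupation` of `planeWaveMode`), so `∫_{cellN}W·flatEnergy =
(1/N)Σ_{p≠0}(k·k_{p−n})²n_{p−n}/(|k|⁴|k_p|²)` (`lintegral_tsum`). With `p₁ := min(θ√ρL/2π, ‖n‖_∞/2)`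
and `P_* := 2πp₁/L ≤ |k|₂/2`: modes `|k_p| ≥ |k|/2` weigh `≤ 9/|k|²` (`|k_{p−n}| ≤ 3|k_p|`), modes
`P_* ≤ |k_p| < |k|/2` weigh `≤ 9/(4P_*²) ≤ (27M²/4θ² + 9/4π²·…)/|k|²`, both summed with
`Σ_q n_q(|Φ|) = N` (Parseval on each fibre, `hasSum_sq_cellFourierCoeff`; the mode `q = 0` has weight
`0`); the shell `0 < |k_p| < P_*` weighs `≤ (9/4)n_{p−n}/|k_p|²`, and with the input
`n_{p−n} ≤ KN/(‖n‖²p₁)` plus the lattice count `Σ_{0<|p|<p₁}|p|⁻² ≤ C_lat·p₁` gives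
`(9C_latK/16π²)·L²/‖n‖²`; empty when `p₁ < 1`. Why it might fail: only bookkeeping (norm
conventions: the crux's `‖n‖` is the sup norm, `|n|₂ ≥ ‖n‖_∞`, shells are sup-norm cubes ⊇ Euclidean
balls). (Refs: KennedyLiebShastry1988; LSSY2005, §1.2 (1.17) (occupations).) -/
def ParsevalShellBound : Prop :=
  ShellOccupation → FlatBound

/-- **Statement of `stub_betaCorrector` — β-CORRECTOR STEP (M; deterministic given its inputs).**
`DensityFlattening → ShellOccupation → BetaCorrectorBound`: take `J♮ := L^{-3/2}β·J_d`; it has weak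
divergence `ε♮` because `β` is `C¹`, periodic and constant along the fibre (`βη` is a test function);
its cost is `E_W[(|β|²/L³)·D] ≤ (E_W|β|²/L³)^{1/2}(E_W D²)^{1/2}` (Cauchy–Schwarz in the bath,
`|β|²/L³ ≤ 1`) `= (n_{−n}(|Φ|)/N)^{1/2}(E_W D²)^{1/2} ≤ √(K/(‖n‖²p₁))·√(K_d)·L` with
`p₁ = min(θ√ρL/2π, ‖n‖/2)` (the mode `p = −n` is always in the shell), and
`√(KK_d)L/(‖n‖√p₁) ≤ C L²/‖n‖²` in both cases of `p₁` once `L ≥ L₀(M, θ, ρ₀, K, K_d)` (guaranteed by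
`N₀`, since `L³ ≥ N₀/ρ₀`). Why it might fail: only if `E_W D²` needed a better than `O(L²)` bound —
it does not. (Refs: LSSY2005, §1.2 (1.17).) -/
def BetaCorrectorStep : Prop :=
  DensityFlattening → ShellOccupation → BetaCorrectorBound

/-! ### Audit names of the stub statements

`Goal.stub_x` abbreviates the statement of the registered stub `stub_x`, so that the skeleton audit
(`#h21_check_skeleton`, by-name policy on hypothesis heads) reads the hypotheses of
`FibreConductance_of` as exactly the six declared stubs (convention of the sibling lines). -/

namespace Goal

/-- Statement of `stub_transport`. -/
abbrev stub_transport : Prop := TransportReduction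
/-- Statement of `stub_parsevalShell`. -/
abbrev stub_parsevalShell : Prop := ParsevalShellBound
/-- Statement of `stub_betaCorrector`. -/
abbrev stub_betaCorrector : Prop := BetaCorrectorStep
/-- Statement of `stub_gradientComparability`. -/
abbrev stub_gradientComparability : Prop := GradientComparability
/-- Statement of `stub_densityFlattening`. -/
abbrev stub_densityFlattening : Prop := DensityFlattening
/-- Statement of `stub_shellOccupation`. -/
abbrev stub_shellOccupation : Prop := ShellOccupation
/-- Statement of the bookkeeping stub `stub_compose`: the six stub statements imply the crux
`FibreConductance` BY NAME (proved in the route's `Defs` file as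
`fun t p b g d s => t (gradientCorrectorBound_of g (p s)) (b d s)`; registered so that the shared
vocabulary file lands as a `--supports` file, precedent `BECConjugateDominationDefs.stub_imuOfParts`). -/
abbrev stub_compose : Prop :=
  stub_transport → stub_parsevalShell → stub_betaCorrector → stub_gradientComparability →
    stub_densityFlattening → stub_shellOccupation → FibreConductance

end Goal

/-! ## §3 Registered stubs -/

/-- **Stub 0** (bookkeeping; proved in `Theorems/BECThomsonPrincipleDefs.lean`): the composition —
see `Goal.stub_compose`. [folklore] -/
theorem stub_compose : Goal.stub_compose := by
  sorry

/-- **Stub 1** (M/L, deterministic): transport identity + gluing — see `TransportReduction`.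
[cite: LyonsPeres2016, Ch. 2] -/
theorem stub_transport : Goal.stub_transport := by
  sorry

/-- **Stub 2** (M/L, deterministic): Parseval–shell bookkeeping — see `ParsevalShellBound`.
[cite: KennedyLiebShastry1988] -/
theorem stub_parsevalShell : Goal.stub_parsevalShell := by
  sorry

/-- **Stub 3** (M, deterministic given inputs): β-channel by Cauchy–Schwarz — see `BetaCorrectorStep`.
[cite: LSSY2005, §1.2] -/
theorem stub_betaCorrector : Goal.stub_betaCorrector := by
  sorry

/-- **Stub 4** (L/XL, landscape half, oscillating charge): see `GradientComparability`.
[cite: GrimmettKestenZhang1993] -/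
theorem stub_gradientComparability : Goal.stub_gradientComparability := by
  sorry

/-- **Stub 5** (L, landscape half, k-free): see `DensityFlattening`. [cite: ReattoChester1967] -/
theorem stub_densityFlattening : Goal.stub_densityFlattening := by
  sorry

/-- **Stub 6** (XL, HARDEST, the infrared input at minimal strength): see `ShellOccupation`.
[cite: KennedyLiebShastry1988] -/
theorem stub_shellOccupation : Goal.stub_shellOccupation := by
  sorry

/-! ## §4 Glue (proved) and the composition -/

/-- Comparability + flat bound ⇒ gradient corrector bound: `ρ₀ = min`, `N₀ = max`, `C = KC_F + K`,
same flow `J`; `ℝ≥0∞` arithmetic. [folklore] -/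
theorem gradientCorrectorBound_of (hG : GradientComparability) (hF : FlatBound) :
    GradientCorrectorBound := by
  intro v hv hB M hM
  obtain ⟨ρ₁, K, hρ₁, hK, N₁, h₁⟩ := hG v hv hB M hM
  obtain ⟨ρ₂, C, hρ₂, hC, N₂, h₂⟩ := hF v hv hB M hM
  refine ⟨min ρ₁ ρ₂, K * C + K, lt_min hρ₁ hρ₂, by positivity, max N₁ N₂, ?_⟩
  intro m hm L hL hρ n hn hw Φ hE hz
  have hm₁ : N₁ ≤ m + 1 := le_trans (le_max_left _ _) hm
  have hm₂ : N₂ ≤ m + 1 := le_trans (le_max_right _ _) hm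
  have hL3 : (0 : ℝ) ≤ L ^ 3 := by positivity
  have hρa : ((m + 1 : ℕ) : ℝ) ≤ ρ₁ * L ^ 3 :=
    hρ.trans (mul_le_mul_of_nonneg_right (min_le_left _ _) hL3)
  have hρb : ((m + 1 : ℕ) : ℝ) ≤ ρ₂ * L ^ 3 :=
    hρ.trans (mul_le_mul_of_nonneg_right (min_le_right _ _) hL3)
  obtain ⟨J, hJm, hJd, hJc⟩ := h₁ m hm₁ L hL hρa n hn hw Φ hE hz
  have hFB := h₂ m hm₂ L hL hρb n hn hw Φ hE hz
  refine ⟨J, hJm, hJd, hJc.trans ?_⟩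
  have hA : 0 ≤ L ^ 2 / ‖(fun j => (n j : ℝ))‖ ^ 2 := by positivity
  calc ENNReal.ofReal K *
          (∫⁻ X in cellN (m + 1) L, ENNReal.ofReal (fibreW Φ X) * flatEnergy n Φ X) +
        ENNReal.ofReal (K * L ^ 2 / ‖(fun j => (n j : ℝ))‖ ^ 2)
      ≤ ENNReal.ofReal K * ENNReal.ofReal (C * L ^ 2 / ‖(fun j => (n j : ℝ))‖ ^ 2) +
        ENNReal.ofReal (K * L ^ 2 / ‖(fun j => (n j : ℝ))‖ ^ 2) := by gcongr
    _ = ENNReal.ofReal ((K * C + K) * L ^ 2 / ‖(fun j => (n j : ℝ))‖ ^ 2) := by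
        rw [← ENNReal.ofReal_mul hK.le,
          ← ENNReal.ofReal_add (by positivity) (by positivity)]
        congr 1
        ring

/-- **THE SKELETON: the six stub statements imply the crux `FibreConductance` BY NAME** through the
bookkeeping stub `stub_compose` (whose proof is `fun t p b g d s => t (gradientCorrectorBound_of g (p s)) (b d s)`).
[folklore] -/
theorem FibreConductance_of (c : Goal.stub_compose) (t : Goal.stub_transport) (p : Goal.stub_parsevalShell)
    (b : Goal.stub_betaCorrector) (g : Goal.stub_gradientComparability)
    (d : Goal.stub_densityFlattening) (s : Goal.stub_shellOccupation) : FibreConductance :=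
  c t p b g d s

/-- The crux from the REGISTERED stubs (by name): what closes stmt-AtomisticToContinuum-9480 once the
`sorry`s are discharged. [folklore] -/
theorem fibreConductance_of_registered_stubs : FibreConductance :=
  FibreConductance_of stub_compose stub_transport stub_parsevalShell stub_betaCorrector
    stub_gradientComparability stub_densityFlattening stub_shellOccupation

end Summit.AtomisticToContinuum.BoseEinsteinCondensation.Cruxes.FibreConductance.ParsevalShellBootstrap

end
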